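import Literature.AnabelianGeometry.EtaleTheta.Discharge.Sec3Prop34ConstTateTower
import Literature.AnabelianGeometry.EtaleTheta.RealSpanPrimeCoordinates
import Literature.AlgebraicGeometry.Frobenioids.RealificationDegreeExtension
import Literature.AlgebraicGeometry.Frobenioids.Thm36SubProofs2
import HarnessLib

/-!
# [EtTh] §3 at the Tate tower: `ℝ_{≥0}`-valued degrees on the WEAK realification and the normal form of `ℝ·Φ₀^birat(Y)`
# (toolkit for the `Λ = ℝ` effective-locus clause of Prop. 3.4 (ii))

S. Mochizuki, *The étale theta function and its Frobenioid-theoretic manifestations*, Publ. RIMS **45** (2009), Def. 3.3 (iii)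
p.73 (`Φ₀`, `B₀ → Φ₀^gp`, `Φ₀^birat`), Prop. 3.4 (ii) p.74, Def. 3.6 (i) p.76 (`B₀^ℝ := ℝ·Φ₀^birat`, `F₀^ℝ := ℝ·Φ₀^cnst`)
[cite: MochizukiEtTh2009, Def 3.6 p.76]; the `ℝ`-vector spaces `(Φ₀(Y)^rlf)^gp` and the generating gloss of `ℝ·(−)` are [FrdI]
Def. 2.4 (i) p.48 / Prop. 5.3 p.103 [cite: MochizukiFrdI2008, Def. 2.4(i) p.48].

abc-iut cell, layer L2, seat abc-iut-L2-d2 (gen 5), L2-lead R482 «hE@TateTower» (census A2, GAP G-w5d130-1), part 1 of 2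
(sequel: `Sec3EffRealSpanTateTower.lean`, the clause itself).  PROOF-ONLY.  For the model of record — the Tate tower
`dm = DivisorMonoids.ofGaloisActionConnected TateTower.action TateTower.cuspLaws`, `hpf = TateTowerFrd.hpf`, THE weak realification
data `RealifiedDivisorMonoids.realDataWeak dm hpf` (abc-iut-L6-t12):

* §1 `RlfDegreeWeak.*` — for a WEAKLY perf-factorial `M` and any `ℝ_{≥0}`-valued degree `φ : M^rlf → ℝ_{≥0}`: `φ` is
  `ℝ_{≥0}`-linear (`hom_nnreal_rpow`, weak twin of abc-iut-L1-d2's `IsPerfFactorial.Rlf.hom_nnreal_rpow`), and its real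
  groupification `(M^rlf)^gp → (ℝ, +)` is `ℝ`-LINEAR for `realSMul` (`toAdd_lift_realSMul`) and `≥ 0` on effective classes;
* §2 `RealificationDataLemmas.eq_rsmul_mul_rsmul_of_zpow_eq` — solving `y` from `y^k = G^m · g^n` in an `ℝ`-vector space;
* §3 the tower: the multiplicity at a component `F_j`, read at a base point `s₀`, is an `ℝ_{≥0}`-valued degree on `Φ₀(Y)`,
  hence (weak universal property of the realification, this seat's `RlfUniversalWeak.existsUnique_lift`, with `ℝ` supporting
  `ℝ_{≥0}`, abc-iut-L1-d2's `ArchFrd.Thm36Sub.supports_R_nnreal`) extends to `Φ₀(Y)^rlf → ℝ_{≥0}` (`exists_rlfHom_val_eq`); on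
  `ι(div₀ b)` its groupification reads `c + k·j` for `b(s₀) = ϖ^c U^k` (`toAdd_lift_toRlfGp_divZero`); and the NORMAL FORM
  `exists_eq_rsmul_mul_rsmul`: every element of `ℝ·Φ₀^birat(Y)` is `a • ι[Σ_j F_j] · β • ι(div₀ b₀)` for one reference function
  `b₀` (from the power relation `b^{k₀} = ϖ^m · b₀^{k}` in `B₀(Y)` on a transitive `ℤ`-set, `zpow_eq_const_zpow_mul_zpow`).

HONEST LABEL: elementary verification at CONSTRUCTED data (the Tate tower skeleton of Def. 3.1/3.3); refereed pre-IUT material;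
nothing here bears on [IUTchIII] Cor. 3.12; no side taken; typed ≠ proved — here proved.
-/

noncomputable section

namespace Literature.AnabelianGeometry.EtaleTheta

open CategoryTheory Opposite Function NNReal Literature.AlgebraicGeometry.Frobenioids LogDivisorModel
  LogDivisorModel.GaloisAction

universe u v w

/-! ## §1 `ℝ_{≥0}`-valued degrees on a WEAK realification: `ℝ_{≥0}`-linearity and the real groupification -/

namespace RlfDegreeWeak

variable {M : Type} [CommMonoid M] (hM : IsPerfFactorialWeak M) (φ : hM.Rlf →* Multiplicative ℝ≥0)

/-- **Every homomorphism `M^rlf → ℝ_{≥0}` is `ℝ_{≥0}`-linear** (weak `M`): `φ(a^r) = r · φ(a)`, since `r ↦ φ(a^r)` is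
additive (weak twin of `IsPerfFactorial.Rlf.hom_nnreal_rpow`). [cite: MochizukiFrdI2008, Def. 2.4(ii) p.48] -/
theorem hom_nnreal_rpow (r : ℝ≥0) (a : hM.Rlf) :
    Multiplicative.toAdd (φ (IsPerfFactorialWeak.Rlf.rpow hM r a)) = r * Multiplicative.toAdd (φ a) := by
  have hadd : ∀ s t : ℝ≥0, Multiplicative.toAdd (φ (IsPerfFactorialWeak.Rlf.rpow hM (s + t) a)) =
      Multiplicative.toAdd (φ (IsPerfFactorialWeak.Rlf.rpow hM s a)) +
        Multiplicative.toAdd (φ (IsPerfFactorialWeak.Rlf.rpow hM t a)) := fun s t => by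
    rw [IsPerfFactorialWeak.Rlf.rpow_add, map_mul, toAdd_mul]
  have h := nnreal_map_eq_mul_of_map_add
    (fun s => Multiplicative.toAdd (φ (IsPerfFactorialWeak.Rlf.rpow hM s a))) hadd r
  simpa only [IsPerfFactorialWeak.Rlf.rpow_one] using h

/-- The real groupification `N^gp → (ℝ, +)` of an `ℝ_{≥0}`-valued degree `φ` on a monoid `N` (e.g. `N = M^rlf`), on a
class `[a]`: `φ(a)`. [cite: MochizukiFrdI2008, Def. 2.4(i) p.48] -/
theorem lift_of {N : Type u} [CommMonoid N] (φ : N →* Multiplicative ℝ≥0) (a : N) :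
    Algebra.GrothendieckGroup.lift (PrimeCoord.toRealMul.comp φ) (Algebra.GrothendieckGroup.of a) =
      PrimeCoord.toRealMul (φ a) := by
  have h := Algebra.GrothendieckGroup.lift.symm_apply_apply (PrimeCoord.toRealMul.comp φ)
  rw [Algebra.GrothendieckGroup.lift_symm_apply] at h
  exact DFunLike.congr_fun h a

/-- The same as a real number. [cite: MochizukiFrdI2008, Def. 2.4(i) p.48] -/
theorem toAdd_lift_of {N : Type u} [CommMonoid N] (φ : N →* Multiplicative ℝ≥0) (a : N) :
    Multiplicative.toAdd (Algebra.GrothendieckGroup.lift (PrimeCoord.toRealMul.comp φ) (Algebra.GrothendieckGroup.of a)) =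
      ((Multiplicative.toAdd (φ a) : ℝ≥0) : ℝ) := by
  rw [lift_of]
  rfl

/-- The real groupification of `φ` is `≥ 0` on EFFECTIVE classes `[a]`, `a ∈ N`. [cite: MochizukiFrdI2008, Def. 2.4(i) p.48] -/
theorem toAdd_lift_of_nonneg {N : Type u} [CommMonoid N] (φ : N →* Multiplicative ℝ≥0) (a : N) :
    0 ≤ Multiplicative.toAdd
      (Algebra.GrothendieckGroup.lift (PrimeCoord.toRealMul.comp φ) (Algebra.GrothendieckGroup.of a)) := by
  rw [toAdd_lift_of]
  exact NNReal.coe_nonneg _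

/-- **The real groupification of `φ` is `ℝ`-LINEAR** for the vector-space structure `realSMul` of `(M^rlf)^gp`
([FrdI] Def. 2.4 (i)): `φ^gp(r • ξ) = r · φ^gp(ξ)`. [cite: MochizukiFrdI2008, Def. 2.4(i) p.48] -/
theorem toAdd_lift_realSMul (r : ℝ) (ξ : Algebra.GrothendieckGroup hM.Rlf) :
    Multiplicative.toAdd (Algebra.GrothendieckGroup.lift (PrimeCoord.toRealMul.comp φ)
        (IsPerfFactorialWeak.Rlf.realSMul hM r ξ)) =
      r * Multiplicative.toAdd (Algebra.GrothendieckGroup.lift (PrimeCoord.toRealMul.comp φ) ξ) := by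
  obtain ⟨a, b, rfl⟩ := IsPerfFactorialWeak.Rlf.gp_exists_eq_div hM ξ
  rw [map_div (IsPerfFactorialWeak.Rlf.realSMul hM r), IsPerfFactorialWeak.Rlf.realSMul_of,
    IsPerfFactorialWeak.Rlf.realSMul_of]
  simp only [map_div, toAdd_div, toAdd_lift_of, hom_nnreal_rpow, NNReal.coe_mul]
  have hr : ((r.toNNReal : ℝ≥0) : ℝ) - (((-r).toNNReal : ℝ≥0) : ℝ) = r := by
    rcases le_total 0 r with h0 | h0
    · rw [Real.coe_toNNReal r h0, Real.toNNReal_of_nonpos (neg_nonpos.mpr h0), NNReal.coe_zero, sub_zero]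
    · rw [Real.toNNReal_of_nonpos h0, Real.coe_toNNReal (-r) (neg_nonneg.mpr h0), NNReal.coe_zero, zero_sub, neg_neg]
  linear_combination (((Multiplicative.toAdd (φ a) : ℝ≥0) : ℝ) - ((Multiplicative.toAdd (φ b) : ℝ≥0) : ℝ)) * hr

end RlfDegreeWeak

/-! ## §2 Solving a power relation in the `ℝ`-vector space of a realification datum -/

namespace RealificationDataLemmas

variable {D : Type u} [Category.{v} D] {Φ : Dᵒᵖ ⥤ CommMonCat.{w}} (R : RealificationData Φ)

/-- `z • x = x^z` for `z ∈ ℤ`. [cite: MochizukiFrdI2008, Def. 2.4(i) p.48] -/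
private theorem rsmul_intCast (X : D) (z : ℤ) (x : Algebra.GrothendieckGroup (R.rlf.obj (op X))) :
    R.rsmul X (z : ℝ) x = x ^ z := by
  cases z with
  | ofNat n => rw [Int.ofNat_eq_natCast, Int.cast_natCast, R.rsmul_natCast, zpow_natCast]
  | negSucc n => rw [Int.cast_negSucc, RealificationDataLemmas.rsmul_neg', R.rsmul_natCast, zpow_negSucc]

/-- **Solving `y` from `y^k = G^m · g^n` (`k ≠ 0`)** in the `ℝ`-vector space `(Φ^rlf)^gp(X)`: `y = (m/k) • G · (n/k) • g`.
[cite: MochizukiFrdI2008, Def. 2.4(i) p.48] -/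
theorem eq_rsmul_mul_rsmul_of_zpow_eq (X : D) {k : ℤ} (hk : k ≠ 0)
    {y G g : Algebra.GrothendieckGroup (R.rlf.obj (op X))} {m n : ℤ} (h : y ^ k = G ^ m * g ^ n) :
    y = R.rsmul X ((m : ℝ) / k) G * R.rsmul X ((n : ℝ) / k) g := by
  have hk' : (k : ℝ) ≠ 0 := Int.cast_ne_zero.mpr hk
  calc y = R.rsmul X ((k : ℝ)⁻¹ * k) y := by rw [inv_mul_cancel₀ hk', R.rsmul_one]
    _ = R.rsmul X (k : ℝ)⁻¹ (G ^ m * g ^ n) := by rw [R.rsmul_mul, rsmul_intCast, h]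
    _ = R.rsmul X ((m : ℝ) / k) G * R.rsmul X ((n : ℝ) / k) g := by
      rw [map_mul, ← rsmul_intCast R X m G, ← rsmul_intCast R X n g, ← R.rsmul_mul, ← R.rsmul_mul,
        inv_mul_eq_div, inv_mul_eq_div]

end RealificationDataLemmas

/-! ## §3 The Tate tower -/

namespace LogDivisorModel.TateTower

open TateTowerFrd

variable (S : Action (Type 0) (Multiplicative ℤ))

/-- The divisor of `b ∈ B₀(S)` at `s`, read at the component `F_j`: `c + k·j` for `b(s) = ϖ^c U^k`. [cite: MochizukiEtTh2009, Def 3.1 p.70] -/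
theorem val_divAt_inr (b : TateTower.action.bZero S) (s : S.V) (j : ℤ) :
    val (TateTower.action.divAt S b s) (Sum.inr j) =
      (Multiplicative.toAdd (b.1 s)).1 + (Multiplicative.toAdd (b.1 s)).2 * j := by
  change Multiplicative.toAdd (divHom (b.1 s)) (Sum.inr j) = _
  rw [toAdd_divHom]
  rfl

/-- `div₀ b = [N]/[D]` read at `F_j`: `(c + k·j) + mult_{F_j} D(s) = mult_{F_j} N(s)` for `b(s) = ϖ^c U^k`.
[cite: MochizukiEtTh2009, Def 3.3 p.73] -/
theorem val_divNum_inr (b : TateTower.action.bZero S) (s : S.V) (j : ℤ) :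
    (Multiplicative.toAdd (b.1 s)).1 + (Multiplicative.toAdd (b.1 s)).2 * j +
        val ((TateTower.action.divDen S b).1 s) (Sum.inr j) =
      val ((TateTower.action.divNum S b).1 s) (Sum.inr j) := by
  rw [← val_divAt_inr, ← TateTower.action.divAt_mul_divDen]
  rfl

/-- On a TRANSITIVE `ℤ`-set, an equivariant function whose value at `s₀` is a constant `ϖ^c` is constant.
[cite: MochizukiEtTh2009, Def 3.3 p.73] -/
theorem apply_eq_of_apply_eq_const (htrans : ∀ s t : S.V, ∃ g : Multiplicative ℤ, S.ρ g s = t) (s₀ : S.V)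
    (b : TateTower.action.bZero S) {c : ℤ} (hc : b.1 s₀ = Multiplicative.ofAdd ((c, 0) : ℤ × ℤ)) (s : S.V) :
    b.1 s = Multiplicative.ofAdd ((c, 0) : ℤ × ℤ) := by
  obtain ⟨g, rfl⟩ := htrans s₀ s
  rw [b.2.2 g s₀, hc, actFn_eq_shearFn, shearFn_const]

/-- **The power relation in `B₀(S)` on a transitive `ℤ`-set**: for `b₀(s₀) = ϖ^{c₀} U^{k₀}` and `b(s₀) = ϖ^c U^k`,
`b^{k₀} = ϖ^{c k₀ - c₀ k} · b₀^{k}` (both sides are equivariant and agree at `s₀`). [cite: MochizukiEtTh2009, Def 3.3 p.73] -/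
theorem zpow_eq_const_zpow_mul_zpow (htrans : ∀ s t : S.V, ∃ g : Multiplicative ℤ, S.ρ g s = t) (s₀ : S.V)
    (b₀ b : TateTower.action.bZero S) {c₀ k₀ c k : ℤ}
    (hb₀ : b₀.1 s₀ = Multiplicative.ofAdd (c₀, k₀)) (hb : b.1 s₀ = Multiplicative.ofAdd (c, k)) :
    b ^ k₀ = (⟨_, const_mem_bZero S 1⟩ : TateTower.action.bZero S) ^ (c * k₀ - c₀ * k) * b₀ ^ k := by
  refine Subtype.ext (funext fun s => ?_)
  obtain ⟨g, rfl⟩ := htrans s₀ s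
  rw [Subgroup.coe_mul, SubgroupClass.coe_zpow, SubgroupClass.coe_zpow, SubgroupClass.coe_zpow, Pi.mul_apply,
    Pi.pow_apply, Pi.pow_apply, Pi.pow_apply, b.2.2 g s₀, b₀.2.2 g s₀, hb, hb₀, actFn_eq_shearFn, actFn_eq_shearFn]
  change Multiplicative.toAdd ((shearFn (Multiplicative.toAdd g) (Multiplicative.ofAdd (c, k))) ^ k₀) =
    Multiplicative.toAdd ((Multiplicative.ofAdd ((1 : ℤ), (0 : ℤ))) ^ (c * k₀ - c₀ * k) *
      (shearFn (Multiplicative.toAdd g) (Multiplicative.ofAdd (c₀, k₀))) ^ k)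
  simp only [toAdd_zpow, toAdd_mul, toAdd_shearFn, toAdd_ofAdd, Prod.smul_mk, smul_eq_mul, Prod.mk_add_mk,
    Prod.mk.injEq]
  constructor <;> ring

end LogDivisorModel.TateTower

namespace TateTowerFrd

open LogDivisorModel.TateTower RealifiedDivisorMonoids

/-- `ι : Φ₀(Y)^gp → (Φ₀(Y)^rlf)^gp` of THE weak realification data on a class `[φ]`: the class of the image of `φ` in
`Φ₀(Y)^rlf`. [cite: MochizukiFrdI2008, Prop. 5.3 p.103] -/
theorem realDataWeak_toRlfGp_of (Y : D₀) (φ : TateTower.action.phiZero Y.obj) :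
    (realDataWeak dm hpf).toRlfGp Y (Algebra.GrothendieckGroup.of (φ : dm.Φ₀.obj (op Y))) =
      Algebra.GrothendieckGroup.of ((hpf (op Y)).weak.toRealification (Perfection.of _ φ)) := by
  rw [RealificationData.toRlfGp, MonGp.map_of, RealificationData.canonicalWeak_toRlf_app_hom]
  rfl

/-- **The multiplicity at `F_j`, read at a base point `s₀`, extends to an `ℝ_{≥0}`-valued degree on `Φ₀(Y)^rlf`** (weak
realification): `φ ↦ mult_{F_j}(φ(s₀))` is a homomorphism `Φ₀(Y) → ℝ_{≥0}`, extended to `Φ₀(Y)^pf` (`ℝ_{≥0}` is perfect) and then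
to `Φ₀(Y)^rlf` by the weak universal property of the realification (`ℝ` supports `ℝ_{≥0}`). [cite: MochizukiFrdI2008, Prop. 5.3 p.103] -/
theorem exists_rlfHom_val_eq (Y : D₀) (s₀ : Y.obj.V) (j : ℤ) :
    ∃ κ : ((realDataWeak dm hpf).rlf.obj (op Y)) →* Multiplicative ℝ≥0, ∀ φ : TateTower.action.phiZero Y.obj,
      ((Multiplicative.toAdd (κ ((hpf (op Y)).weak.toRealification (Perfection.of _ φ))) : ℝ≥0) : ℝ) =
        (val (φ.1 s₀) (Sum.inr j) : ℝ) := by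
  have hnn : ∀ φ : TateTower.action.phiZero Y.obj, 0 ≤ val (φ.1 s₀) (Sum.inr j) := fun φ =>
    (Submonoid.mem_inf.mp (φ.2.1 s₀)).2 (Sum.inr j)
  -- the multiplicity at `F_j` of `φ(s₀)`, an `ℝ_{≥0}`-valued degree on `Φ₀(Y)`
  let χ : TateTower.action.phiZero Y.obj →* Multiplicative ℝ≥0 :=
    { toFun := fun φ => Multiplicative.ofAdd (Real.toNNReal (val (φ.1 s₀) (Sum.inr j) : ℝ))
      map_one' := by
        have h0 : val ((1 : TateTower.action.phiZero Y.obj).1 s₀) (Sum.inr j) = 0 := rfl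
        rw [h0, Int.cast_zero, Real.toNNReal_zero]
        rfl
      map_mul' := fun φ ψ => by
        have hm : val ((φ * ψ).1 s₀) (Sum.inr j) = val (φ.1 s₀) (Sum.inr j) + val (ψ.1 s₀) (Sum.inr j) := rfl
        rw [← ofAdd_add, hm, Int.cast_add,
          Real.toNNReal_add (Int.cast_nonneg (hnn φ)) (Int.cast_nonneg (hnn ψ))] }
  have hχ : ∀ φ, ((Multiplicative.toAdd (χ φ) : ℝ≥0) : ℝ) = (val (φ.1 s₀) (Sum.inr j) : ℝ) := fun φ =>
    Real.coe_toNNReal _ (Int.cast_nonneg (hnn φ))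
  obtain ⟨κ, hκ, -⟩ := RlfUniversalWeak.existsUnique_lift (hpf (op Y)).weak (hpf (op Y)).rlfCofinal
    ArchFrd.Thm36Sub.supports_R_nnreal
    (isPerfect_multiplicative_nnreal.equivPerfection.symm.toMonoidHom.comp
      (Literature.AlgebraicGeometry.Frobenioids.Perfection.map χ))
  refine ⟨κ, fun φ => ?_⟩
  have h1 : κ ((hpf (op Y)).weak.toRealification (Perfection.of _ φ)) = χ φ :=
    (DFunLike.congr_fun hκ (Perfection.of _ φ)).trans
      (DFunLike.congr_fun (IsPerfFactorial.perfectionExtend_spec χ) φ)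
  exact (congrArg (fun y : Multiplicative ℝ≥0 => ((Multiplicative.toAdd y : ℝ≥0) : ℝ)) h1).trans (hχ φ)

/-- A degree `κ` on `Φ₀(Y)^rlf`, groupified, on the class of an element `t ∈ Φ₀(Y)^rlf` (the class taken in `(Φ₀(Y)^rlf)^gp`):
`κ(t)` as a real number.
[cite: MochizukiFrdI2008, Def. 2.4(i) p.48] -/
theorem toAdd_lift_of_rlf (Y : D₀) (κ : ((realDataWeak dm hpf).rlf.obj (op Y)) →* Multiplicative ℝ≥0)
    (t : (hpf (op Y)).weak.Rlf) :
    Multiplicative.toAdd (Algebra.GrothendieckGroup.lift (PrimeCoord.toRealMul.comp κ)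
        (Algebra.GrothendieckGroup.of (M := (hpf (op Y)).weak.Rlf) t)) =
      ((Multiplicative.toAdd (κ t) : ℝ≥0) : ℝ) :=
  RlfDegreeWeak.toAdd_lift_of κ t

/-- **The degree "multiplicity at `F_j`" on `ι(div₀ b)` reads `c + k·j`** for `b(s₀) = ϖ^c U^k` (`div₀ b = [N]/[D]` with
`div(b(s₀)) · D(s₀) = N(s₀)`). [cite: MochizukiEtTh2009, Def 3.3 p.73] -/
theorem toAdd_lift_toRlfGp_divZero (Y : D₀) (s₀ : Y.obj.V) (j : ℤ)
    (κ : ((realDataWeak dm hpf).rlf.obj (op Y)) →* Multiplicative ℝ≥0)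
    (hκ : ∀ φ : TateTower.action.phiZero Y.obj,
      ((Multiplicative.toAdd (κ ((hpf (op Y)).weak.toRealification (Perfection.of _ φ))) : ℝ≥0) : ℝ) =
        (val (φ.1 s₀) (Sum.inr j) : ℝ))
    (b : TateTower.action.bZero Y.obj) :
    Multiplicative.toAdd (Algebra.GrothendieckGroup.lift (PrimeCoord.toRealMul.comp κ)
        ((realDataWeak dm hpf).toRlfGp Y (TateTower.action.divZero Y.obj b))) =
      ((Multiplicative.toAdd (b.1 s₀)).1 : ℝ) + (Multiplicative.toAdd (b.1 s₀)).2 * j := by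
  -- `ι` retyped over `Φ₀(Y.obj)^gp`
  let ι : Algebra.GrothendieckGroup ↥(TateTower.action.phiZero Y.obj) →*
      Algebra.GrothendieckGroup ((realDataWeak dm hpf).rlf.obj (op Y)) := (realDataWeak dm hpf).toRlfGp Y
  have hι : ∀ φ : TateTower.action.phiZero Y.obj, ι (Algebra.GrothendieckGroup.of φ) =
      Algebra.GrothendieckGroup.of ((hpf (op Y)).weak.toRealification (Perfection.of _ φ)) := fun φ =>
    realDataWeak_toRlfGp_of Y φ
  have hN := hκ (TateTower.action.divNum Y.obj b)
  have hD := hκ (TateTower.action.divDen Y.obj b)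
  have hrel := congrArg (fun z : ℤ => (z : ℝ)) (val_divNum_inr Y.obj b s₀ j)
  simp only [Int.cast_add, Int.cast_mul] at hrel
  change Multiplicative.toAdd (Algebra.GrothendieckGroup.lift (PrimeCoord.toRealMul.comp κ)
    (ι (Algebra.GrothendieckGroup.of (TateTower.action.divNum Y.obj b) /
      Algebra.GrothendieckGroup.of (TateTower.action.divDen Y.obj b)))) = _
  rw [map_div, map_div, toAdd_div, hι, hι, toAdd_lift_of_rlf, toAdd_lift_of_rlf, hN, hD]
  linarith

/-- **`ℝ`-linearity of the degrees on `(Φ₀(Y)^rlf)^gp`** for the scalar action of THE weak realification data.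
[cite: MochizukiFrdI2008, Def. 2.4(i) p.48] -/
theorem toAdd_lift_rsmul (Y : D₀) (κ : ((realDataWeak dm hpf).rlf.obj (op Y)) →* Multiplicative ℝ≥0) (r : ℝ)
    (ξ : Algebra.GrothendieckGroup ((realDataWeak dm hpf).rlf.obj (op Y))) :
    Multiplicative.toAdd (Algebra.GrothendieckGroup.lift (PrimeCoord.toRealMul.comp κ) ((realDataWeak dm hpf).rsmul Y r ξ)) =
      r * Multiplicative.toAdd (Algebra.GrothendieckGroup.lift (PrimeCoord.toRealMul.comp κ) ξ) :=
  RlfDegreeWeak.toAdd_lift_realSMul (hpf (op Y)).weak κ r ξ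

/-- **Normal form of `ℝ·Φ₀^birat(Y)` at the tower.**  Fix a base point `s₀` and a reference function `b₀ ∈ B₀(Y)`,
`b₀(s₀) = ϖ^{c₀} U^{k₀}`, such that `k₀ ≠ 0` as soon as SOME `b ∈ B₀(Y)` has a `U`-part at `s₀`; then every element of
`ℝ·Φ₀^birat(Y)` is `a • ι[Σ_j F_j] · β • ι(div₀ b₀)` with `a, β ∈ ℝ`. [cite: MochizukiFrdI2008, Prop. 5.3 p.103] -/
theorem exists_eq_rsmul_mul_rsmul (Y : D₀) (s₀ : Y.obj.V) (b₀ : TateTower.action.bZero Y.obj) {c₀ k₀ : ℤ}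
    (hb₀ : b₀.1 s₀ = Multiplicative.ofAdd (c₀, k₀))
    (H : ∀ b : TateTower.action.bZero Y.obj, (Multiplicative.toAdd (b.1 s₀)).2 ≠ 0 → k₀ ≠ 0)
    {ξ : Algebra.GrothendieckGroup ((realDataWeak dm hpf).rlf.obj (op Y))}
    (hξ : ξ ∈ ((realDataWeak dm hpf).realSpan dm.biratGp).carrier Y) :
    ∃ a β : ℝ, ξ =
      (realDataWeak dm hpf).rsmul Y a ((realDataWeak dm hpf).toRlfGp Y (Algebra.GrothendieckGroup.of
          ((⟨_, constDIV_one_mem_phiZero Y.obj⟩ : TateTower.action.phiZero Y.obj) : dm.Φ₀.obj (op Y)))) *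
        (realDataWeak dm hpf).rsmul Y β ((realDataWeak dm hpf).toRlfGp Y (TateTower.action.divZero Y.obj b₀)) := by
  have htrans := Y.property.2
  -- `ι` retyped over `Φ₀(Y.obj)^gp`, the two generators, the predicate
  let R := realDataWeak dm hpf
  let ι : Algebra.GrothendieckGroup ↥(TateTower.action.phiZero Y.obj) →* Algebra.GrothendieckGroup (R.rlf.obj (op Y)) :=
    R.toRlfGp Y
  let d : TateTower.action.phiZero Y.obj := ⟨_, constDIV_one_mem_phiZero Y.obj⟩
  let G₁ := ι (Algebra.GrothendieckGroup.of d)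
  let g₀ := ι (TateTower.action.divZero Y.obj b₀)
  let P : Algebra.GrothendieckGroup (R.rlf.obj (op Y)) → Prop := fun x => ∃ a β : ℝ, x = R.rsmul Y a G₁ * R.rsmul Y β g₀
  -- `P` is a subgroup predicate stable under the scalars
  have P1 : P 1 := ⟨0, 0, by rw [R.rsmul_zero, R.rsmul_zero, mul_one]⟩
  have Pmul : ∀ x y, P x → P y → P (x * y) := by
    rintro x y ⟨a, β, rfl⟩ ⟨a', β', rfl⟩
    exact ⟨a + a', β + β', by rw [R.rsmul_add, R.rsmul_add, mul_mul_mul_comm]⟩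
  have Pinv : ∀ x, P x → P x⁻¹ := by
    rintro x ⟨a, β, rfl⟩
    exact ⟨-a, -β, by rw [RealificationDataLemmas.rsmul_neg', RealificationDataLemmas.rsmul_neg', mul_inv]⟩
  have Psmul : ∀ (r : ℝ) x, P x → P (R.rsmul Y r x) := by
    rintro r x ⟨a, β, rfl⟩
    exact ⟨r * a, r * β, by rw [map_mul, R.rsmul_mul, R.rsmul_mul]⟩
  -- `div₀(ϖ) = [Σ_j F_j]`
  have hd : ∀ s, d.1 s = (constDIV 1 : TateTower.model.DIV) := fun _ => rfl
  have hϖ : TateTower.action.divZero Y.obj ⟨_, const_mem_bZero Y.obj 1⟩ = Algebra.GrothendieckGroup.of d := by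
    have h := divZero_eq_zpow_of_forall_eq Y.obj d hd ⟨_, const_mem_bZero Y.obj 1⟩ 1 (fun _ => rfl)
    rw [zpow_one] at h
    exact h
  -- the generators `ι(div₀ b)` of `ι(Φ₀^birat(Y))`
  have Pgen : ∀ b : TateTower.action.bZero Y.obj, P (ι (TateTower.action.divZero Y.obj b)) := by
    intro b
    by_cases hk : (Multiplicative.toAdd (b.1 s₀)).2 = 0
    · -- `b` is the constant `ϖ^c`: `div₀ b = c·[Σ F_j]`
      have hc0 : b.1 s₀ = Multiplicative.ofAdd (((Multiplicative.toAdd (b.1 s₀)).1, 0) : ℤ × ℤ) :=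
        Multiplicative.toAdd.injective (Prod.ext rfl hk)
      have hc := apply_eq_of_apply_eq_const Y.obj htrans s₀ b hc0
      refine ⟨(Multiplicative.toAdd (b.1 s₀)).1, 0, ?_⟩
      rw [divZero_eq_zpow_of_forall_eq Y.obj d hd b _ hc, map_zpow, R.rsmul_zero, mul_one,
        RealificationDataLemmas.rsmul_intCast]
    · -- `b^{k₀} = ϖ^m · b₀^k`, solved in the `ℝ`-vector space
      have hk₀ : k₀ ≠ 0 := H b hk
      have hpow := zpow_eq_const_zpow_mul_zpow Y.obj htrans s₀ b₀ b hb₀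
        (rfl : b.1 s₀ = Multiplicative.ofAdd ((Multiplicative.toAdd (b.1 s₀)).1, (Multiplicative.toAdd (b.1 s₀)).2))
      have h2 := congrArg (ι.comp (TateTower.action.divZeroHom Y.obj)) hpow
      simp only [map_zpow, map_mul, MonoidHom.comp_apply, TateTower.action.divZeroHom_apply, hϖ] at h2
      exact ⟨_, _, RealificationDataLemmas.eq_rsmul_mul_rsmul_of_zpow_eq R Y hk₀ h2⟩
  -- `ι(Φ₀^birat(Y))`: the subgroup generated by the `div₀ b`
  have Pbirat : ∀ c ∈ dm.biratGp.carrier Y, P (R.toRlfGp Y c) := by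
    intro c hc
    induction hc using Subgroup.closure_induction with
    | mem y hy =>
      obtain ⟨b, rfl⟩ := hy
      exact Pgen b
    | one => rw [map_one]; exact P1
    | mul y z _ _ hy hz => rw [map_mul]; exact Pmul _ _ hy hz
    | inv y _ hy => rw [map_inv]; exact Pinv _ hy
  -- the span
  have key : ∀ x ∈ (R.realSpan dm.biratGp).carrier Y, P x := by
    intro x hx
    induction hx using Subgroup.closure_induction with
    | mem y hy =>
      obtain ⟨r, c, hc, rfl⟩ := hy
      exact Psmul r _ (Pbirat c hc)
    | one => exact P1
    | mul y z _ _ hy hz => exact Pmul _ _ hy hz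
    | inv y _ hy => exact Pinv _ hy
  exact key ξ hξ

end TateTowerFrd

end Literature.AnabelianGeometry.EtaleTheta

end
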